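import Summits.HubbardSuperconductivity.HubbardSuperconductivity.Theorems.BirComplexStableXY.Negative.WitnessTable

/-!
# A-priori bound on the engine's partition function (route BalabanIR, crux `BirComplexStableXY`)

Helper file of the negative lane of stmt-HubbardSuperconductivity-2080 / the glue item
stmt-HubbardSuperconductivity-2082 (prover seat c3-0, 2026-08-16).  For ANY window table `c` and real coupling `K` on
the torus `Λ = (ℤ/L)² × ℤ/M`:
* `norm_genF_le_normA` : `‖F(φ)‖ ≤ normA c` (the (A)-norm dominates the plain `ℓ¹` norm);
* `norm_action_le`     : `‖A(θ)‖ ≤ |K| · |Λ| · normA c`;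
* `volume_cube`        : `vol [0,2π]^Λ = (2π)^{|Λ|}`;
* `norm_partZ_le`      : `‖Z‖ ≤ e^{|K| |Λ| normA c} (2π)^{|Λ|}`;
* `norm_partZ_le_exp`  : for `normA c ≤ 128` (the admissible bound `B = 128` of the witness / stiffness families),
  `‖Z_M‖ ≤ exp (M · |(ℤ/L)²| · (128|K| + log 2π))` — the exponential-in-`M` growth bound that feeds the
  Beraha–Kahane–Weiss / Vitali argument (`Literature.Analysis.Complex.ZeroFreeGrowthRigidity`).
Elementary (`norm_setIntegral_le_of_norm_le_const`, `volume_pi_pi`).  No definition is introduced.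
-/

namespace Summit.HubbardSuperconductivity.BirComplexStableXYNegative

open scoped BigOperators
open MeasureTheory Metric Filter Literature.Probability.LatticeModels

noncomputable section

/-! ### Crude a-priori bound on the partition function -/

/-- `‖F(φ)‖ ≤ normA c` for every table and every window configuration. [folklore] -/
theorem norm_genF_le_normA {r : ℕ} (c : Table r) (φ : W r → ℝ) : ‖genF c φ‖ ≤ normA c := by
  unfold genF normA Finsupp.sum
  refine (norm_sum_le _ _).trans (Finset.sum_le_sum fun n _ => ?_)
  rw [norm_mul]
  have h1 : ‖Complex.exp (Complex.I * ((∑ w, (n w : ℝ) * φ w : ℝ) : ℂ))‖ = 1 := by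
    rw [Complex.norm_exp]
    simp
  rw [h1, mul_one]
  have h2 : (1:ℝ) ≤ Real.exp (∑ w, |(n w : ℝ)|) :=
    Real.one_le_exp (Finset.sum_nonneg fun w _ => abs_nonneg _)
  nlinarith [norm_nonneg (c n)]

/-- `‖A(θ)‖ ≤ |K| · |Λ| · normA c`. [folklore] -/
theorem norm_action_le {r : ℕ} (K : ℝ) (c : Table r) (L M : ℕ) [NeZero L] [NeZero M]
    (θ : Λ L M → ℝ) : ‖action K c L M θ‖ ≤ |K| * Fintype.card (Λ L M) * normA c := by
  unfold action
  rw [norm_mul, Complex.norm_real, Real.norm_eq_abs, mul_assoc]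
  gcongr
  calc ‖∑ s : Λ L M, genF c (fun w => θ (sh L M s w))‖
      ≤ ∑ s : Λ L M, ‖genF c (fun w => θ (sh L M s w))‖ := norm_sum_le _ _
    _ ≤ ∑ _s : Λ L M, normA c := Finset.sum_le_sum fun s _ => norm_genF_le_normA c _
    _ = Fintype.card (Λ L M) * normA c := by simp [Finset.sum_const, Finset.card_univ]

/-- The volume of the cube `[0,2π]^Λ`. [folklore] -/
theorem volume_cube (L M : ℕ) [NeZero L] [NeZero M] :
    volume (cube L M) = ENNReal.ofReal (2 * Real.pi) ^ Fintype.card (Λ L M) := by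
  unfold cube
  rw [volume_pi_pi]
  simp [Real.volume_Icc, Finset.prod_const, Finset.card_univ]

/-- A-priori bound `‖Z‖ ≤ (2π)^{|Λ|} e^{|K| |Λ| normA c}`. [folklore] -/
theorem norm_partZ_le {r : ℕ} (K : ℝ) (c : Table r) (L M : ℕ) [NeZero L] [NeZero M] :
    ‖partZ K c L M‖ ≤ Real.exp (|K| * Fintype.card (Λ L M) * normA c) *
      (2 * Real.pi) ^ Fintype.card (Λ L M) := by
  have hvol : volume (cube L M) < ⊤ := by
    rw [volume_cube]
    exact ENNReal.pow_lt_top ENNReal.ofReal_lt_top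
  have hreal : (volume (cube L M)).toReal = (2 * Real.pi) ^ Fintype.card (Λ L M) := by
    rw [volume_cube, ENNReal.toReal_pow, ENNReal.toReal_ofReal (by positivity)]
  have h := norm_setIntegral_le_of_norm_le_const (μ := volume) (s := cube L M)
    (f := fun θ => Complex.exp (-(action K c L M θ)))
    (C := Real.exp (|K| * Fintype.card (Λ L M) * normA c)) hvol (by
      intro θ _
      rw [Complex.norm_exp]
      apply Real.exp_le_exp.mpr
      calc (-(action K c L M θ)).re ≤ ‖-(action K c L M θ)‖ := Complex.re_le_norm _
        _ = ‖action K c L M θ‖ := norm_neg _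
        _ ≤ _ := norm_action_le K c L M θ)
  rw [measureReal_def, hreal] at h
  exact h

/-- `|Λ| = |(ℤ/L)²| · M`. [folklore] -/
theorem card_Λ (L M : ℕ) [NeZero L] [NeZero M] :
    Fintype.card (Λ L M) = Fintype.card (TorusSite 2 L) * M := by
  simp [Fintype.card_prod, ZMod.card]

/-- Exponential-in-`M` form of the a-priori bound for tables with `normA c ≤ 128`:
`‖Z_M‖ ≤ exp (M · |(ℤ/L)²| · (128|K| + log 2π))`. [folklore] -/
theorem norm_partZ_le_exp {r : ℕ} (K : ℝ) (c : Table r) (hc : normA c ≤ 128) (L M : ℕ) [NeZero L]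
    [NeZero M] :
    ‖partZ K c L M‖ ≤
      Real.exp ((Fintype.card (TorusSite 2 L) * (128 * |K| + Real.log (2 * Real.pi))) * M) := by
  have h := norm_partZ_le K c L M
  rw [card_Λ] at h
  have hpi : (0 : ℝ) < 2 * Real.pi := by positivity
  have hpow : (2 * Real.pi) ^ (Fintype.card (TorusSite 2 L) * M)
      = Real.exp ((Fintype.card (TorusSite 2 L) * M : ℕ) * Real.log (2 * Real.pi)) := by
    rw [Real.exp_nat_mul, Real.exp_log hpi]
  rw [hpow, ← Real.exp_add] at h
  refine h.trans (Real.exp_le_exp.mpr ?_)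
  have hN : (0 : ℝ) ≤ ((Fintype.card (TorusSite 2 L) * M : ℕ) : ℝ) := by positivity
  have hnA : 0 ≤ normA c := by
    unfold normA Finsupp.sum
    exact Finset.sum_nonneg fun n _ => by positivity
  push_cast
  have : |K| * (↑(Fintype.card (TorusSite 2 L)) * ↑M) * normA c
      ≤ |K| * (↑(Fintype.card (TorusSite 2 L)) * ↑M) * 128 := by
    apply mul_le_mul_of_nonneg_left hc
    positivity
  nlinarith [this, abs_nonneg K]

end

end Summit.HubbardSuperconductivity.BirComplexStableXYNegative
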